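import Summits.AtomisticToContinuum.Crystallization.Theorems.OverbindingBudgetRecurrentDustClosure

/-!
# OverbindingBudget — node «RecurrentDust», limit closure II: Burgers-freeness and robust Burgers circuits
(decomp-a2c lens 4, generation 22; helper `--supports stmt-AtomisticToContinuum-31280`; part of the node «RecurrentDust»)

§P developability is a CONTACT-GRAPH property: `developable_of_contactEquiv` (an injection preserving and reflecting contacts at
threshold `1.02a` pulls developability back), `contact_iff_of_clean` (partners, under an `ε`-matching, of two sites one of which is
`t`-robustly clean with `2ε ≤ t` have the same contact relation — clean pair distances are `≤ 1.02a - t` or `≥ 1.26a + t`);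
§Q `burgersFree_of_limit` (no pigeonhole: transport the clean finite set into one good approximant), `burgersDenseL_of_limit`
(pigeonhole the transported circuit among the finitely many subsets of a ball of the limit along `ε → 0⁺`). [folklore techniques]
-/

noncomputable section

namespace Summit.AtomisticToContinuum.Crystallization.Theorems.OverbindingBudgetRecurrentDustClosureTwo

open Filter Metric Set Topology
open Literature.MathematicalPhysics.StatisticalMechanics
open Summit.AtomisticToContinuum.Crystallization.Theorems.OverbindingBudgetWallTensionLever (CleanT TouchT Linked ThinCores BarlowClose)
open Summit.AtomisticToContinuum.Crystallization.Theorems.OverbindingBudgetViolatorDensityFloor (GT RT)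
open Summit.AtomisticToContinuum.Crystallization.Theorems.OverbindingBudgetCleanlessCut (margin_le_of_cleanT)
open Summit.AtomisticToContinuum.Crystallization.Theorems.OverbindingBudgetRecurrentSealStatements
open Summit.AtomisticToContinuum.Crystallization.Theorems.OverbindingBudgetRecurrentSealClosure
open Summit.AtomisticToContinuum.Crystallization.Theorems.OverbindingBudgetRecurrentDustStatements
open Summit.AtomisticToContinuum.Crystallization.Theorems.OverbindingBudgetRecurrentDustClosure

/-! ## §P  Developability is a contact-graph property -/

/-- An injection of a finite set that preserves and reflects contacts at threshold `1.02 a` pulls developability back: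
developability depends on the set only through its contact graph. [folklore] -/
theorem developable_of_contactEquiv {a : ℝ} {S : Finset (EuclideanSpace ℝ (Fin 3))}
    {ψ : (EuclideanSpace ℝ (Fin 3)) → (EuclideanSpace ℝ (Fin 3))} (hinj : Set.InjOn ψ (↑S : Set (EuclideanSpace ℝ (Fin 3))))
    (hiff : ∀ y ∈ S, ∀ y' ∈ S, y ≠ y' → (dist y y' ≤ a * (1 + 1 / 50) ↔ dist (ψ y) (ψ y') ≤ a * (1 + 1 / 50)))
    (h : Developable a (S.image ψ)) : Developable a S := by
  classical
  obtain ⟨W, hW, u, hu, huW, huiff⟩ := h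
  refine ⟨W, hW, fun p => u (ψ p), ?_, fun y hy => huW _ (Finset.mem_image_of_mem ψ hy), fun y hy y' hy' => ?_⟩
  · intro y hy y' hy' heq
    exact hinj hy hy' (hu (Finset.mem_coe.2 (Finset.mem_image_of_mem ψ hy))
      (Finset.mem_coe.2 (Finset.mem_image_of_mem ψ hy')) heq)
  · have key := huiff (ψ y) (Finset.mem_image_of_mem ψ hy) (ψ y') (Finset.mem_image_of_mem ψ hy')
    rw [← key]
    constructor
    · rintro ⟨hne, hd⟩
      exact ⟨fun heq => hne (hinj (Finset.mem_coe.2 hy) (Finset.mem_coe.2 hy') heq), (hiff y hy y' hy' hne).1 hd⟩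
    · rintro ⟨hne, hd⟩
      have hne' : y ≠ y' := fun heq => hne (by rw [heq])
      exact ⟨hne', (hiff y hy y' hy' hne').2 hd⟩

/-- Under an `ε`-perturbation of each point, a `t`-robustly clean site (`2ε ≤ t`) keeps its contact relation to
every other site: clean pair distances are `≤ 1.02a - t` or `≥ 1.26a + t`. [folklore] -/
theorem contact_iff_of_clean {Y : Set (EuclideanSpace ℝ (Fin 3))} {a t ε : ℝ} {y y' q q' : (EuclideanSpace ℝ (Fin 3))}
    (ha : 47 / 50 ≤ a) (hε0 : 0 ≤ ε) (hεt : 2 * ε ≤ t) (hy' : y' ∈ Y) (hne : y ≠ y')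
    (hc : CleanT a t Y y) (hd : dist y q ≤ ε) (hd' : dist y' q' ≤ ε) :
    (dist y y' ≤ a * (1 + 1 / 50) ↔ dist q q' ≤ a * (1 + 1 / 50)) := by
  obtain ⟨hlo, hdich⟩ := hc.2.1 y' hy' (Ne.symm hne)
  have hup : dist q q' ≤ dist y y' + (ε + ε) := by
    have h1 := dist_triangle q y q'
    have h2 := dist_triangle y y' q'
    have h3 := dist_comm q y
    linarith
  have hdown : dist y y' ≤ dist q q' + (ε + ε) := by
    have h1 := dist_triangle y q y'
    have h2 := dist_triangle q q' y'
    have h3 := dist_comm q' y'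
    linarith
  constructor
  · intro h
    rcases hdich with h1 | h1
    · linarith
    · nlinarith
  · intro h
    rcases hdich with h1 | h1
    · linarith
    · nlinarith

/-! ## §Q  Limit closure of Burgers-freeness and of robust Burgers circuits -/

/-- Burgers-freeness passes to local limits: transport a `t`-robustly clean finite set of the limit into one good approximant
(margin `t - 3ε`), develop it there, and pull developability back along the partner map (`§P`). [folklore] -/
theorem burgersFree_of_limit {δ a : ℝ} (hδ : 0 < δ) (ha : 47 / 50 ≤ a) (ha1 : a ≤ 1)
    {Zs : ℕ → Set (EuclideanSpace ℝ (Fin 3))} {Z : Set (EuclideanSpace ℝ (Fin 3))} (hsepk : ∀ k, ∀ p ∈ Zs k, ∀ q ∈ Zs k, p ≠ q → δ ≤ dist p q)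
    (hsep : ∀ p ∈ Z, ∀ q ∈ Z, p ≠ q → δ ≤ dist p q)
    (hconv : ∀ R ε : ℝ, 0 < ε → ∀ᶠ k in atTop, Match ε R 0 (Zs k) Z)
    (hB : ∀ k, BurgersFree a (Zs k)) : BurgersFree a Z := by
  classical
  have ha0 : 0 < a := by linarith
  intro t ht S hSZ hcl
  set R₁ : ℝ := ∑ y ∈ S, ‖y‖ with hR₁
  have hR₁y : ∀ y ∈ S, ‖y‖ ≤ R₁ := fun y hy =>
    Finset.single_le_sum (f := fun y : (EuclideanSpace ℝ (Fin 3)) => ‖y‖) (fun _ _ => norm_nonneg _) hy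
  set ε : ℝ := min (t / 4) (min (δ / 4) (1 / 200)) with hεdef
  have hε0 : 0 < ε := by positivity
  have hεt : 4 * ε ≤ t := by
    have := min_le_left (t / 4) (min (δ / 4) (1 / 200)); linarith
  have hεδ : 2 * ε < δ := by
    have := (min_le_right (t / 4) (min (δ / 4) (1 / 200))).trans (min_le_left _ _); linarith
  have hε200 : ε ≤ 1 / 200 := (min_le_right _ _).trans (min_le_right _ _)
  have hεa : 100 * ε ≤ a := by linarith
  obtain ⟨k, hk⟩ := (hconv (R₁ + 2) ε hε0).exists
  choose! ψ hψB hψd using hk.1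
  have hSZ' : ∀ y ∈ S, y ∈ Z := fun y hy => hSZ (Finset.mem_coe.2 hy)
  have hyR : ∀ y ∈ S, dist y 0 ≤ R₁ + 2 := fun y hy => by rw [dist_zero_right]; linarith [hR₁y y hy]
  have hψ : ∀ y ∈ S, ψ y ∈ Zs k ∧ dist y (ψ y) ≤ ε := fun y hy =>
    ⟨hψB y (hSZ' y hy) (hyR y hy), by rw [dist_comm]; exact hψd y (hSZ' y hy) (hyR y hy)⟩
  -- transported cleanness
  have hcl' : ∀ y ∈ S, CleanT a (t - 3 * ε) (Zs k) (ψ y) := by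
    intro y hy
    have hc := hcl y hy
    have hta := margin_le_of_cleanT hc
    exact cleanT_of_match' hsep (hsepk k) hε0.le hεδ hk.symm ha0 hεa (by linarith) hta (by linarith) (by nlinarith)
      (hSZ' y hy) (hψ y hy).1 (hψ y hy).2 (by linarith [hR₁y y hy]) (Or.inl (by linarith)) hc
  have hdev : Developable a (S.image ψ) := by
    refine hB k (t - 3 * ε) (by linarith) (S.image ψ) (fun q hq => ?_) (fun q hq => ?_)
    · obtain ⟨y, hy, rfl⟩ := Finset.mem_image.1 (Finset.mem_coe.1 hq)
      exact (hψ y hy).1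
    · obtain ⟨y, hy, rfl⟩ := Finset.mem_image.1 hq
      exact hcl' y hy
  refine developable_of_contactEquiv (fun y hy y' hy' heq => ?_) (fun y hy y' hy' hne => ?_) hdev
  · by_contra hne
    have h1 := hsep y (hSZ hy) y' (hSZ hy') hne
    have h2 := dist_triangle y (ψ y) y'
    have h3 : dist (ψ y) y' ≤ ε := by rw [heq, dist_comm]; exact (hψ y' hy').2
    linarith [(hψ y hy).2]
  · exact contact_iff_of_clean ha hε0.le (by linarith) (hSZ' y' hy') hne (hcl y hy) (hψ y hy).2 (hψ y' hy').2

/-- `L`-dense robust Burgers circuits pass to local limits: pigeonhole the partner image of the approximants' circuit among the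
finitely many subsets of a ball of the limit along `ε → 0⁺`; cleanness at margin `s < t` comes from margin `s + 3ε < t`,
undevelopability from `§P`. [folklore] -/
theorem burgersDenseL_of_limit {δ a t L M : ℝ} (hδ : 0 < δ) (ha : 47 / 50 ≤ a) (ha1 : a ≤ 1) (ht : 0 < t)
    {Zs : ℕ → Set (EuclideanSpace ℝ (Fin 3))} {Z : Set (EuclideanSpace ℝ (Fin 3))} (hsepk : ∀ k, ∀ p ∈ Zs k, ∀ q ∈ Zs k, p ≠ q → δ ≤ dist p q)
    (hsep : ∀ p ∈ Z, ∀ q ∈ Z, p ≠ q → δ ≤ dist p q)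
    (hconv : ∀ R ε : ℝ, 0 < ε → ∀ᶠ k in atTop, Match ε R 0 (Zs k) Z)
    (hBD : ∀ k, BurgersDenseL a t L M (Zs k)) : BurgersDenseL a t L M Z := by
  classical
  have ha0 : 0 < a := by linarith
  intro p hp
  set R₀ : ℝ := ‖p‖ + |L| + 10 with hR₀
  have hk : ∀ ε : ℝ, ∃ k : ℕ, 0 < ε → Match ε R₀ 0 (Zs k) Z := by
    intro ε
    by_cases hε : 0 < ε
    · obtain ⟨k, hk⟩ := (hconv R₀ ε hε).exists
      exact ⟨k, fun _ => hk⟩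
    · exact ⟨0, fun h => absurd h hε⟩
  choose k hk using hk
  have hp0 : dist p 0 ≤ R₀ := by
    rw [dist_zero_right]; linarith [abs_nonneg L, norm_nonneg p]
  have hpn : ∀ ε : ℝ, ∃ q : (EuclideanSpace ℝ (Fin 3)), 0 < ε → q ∈ Zs (k ε) ∧ dist q p ≤ ε := by
    intro ε
    by_cases hε : 0 < ε
    · obtain ⟨q, hq, hqd⟩ := (hk ε hε).1 p hp hp0
      exact ⟨q, fun _ => ⟨hq, hqd⟩⟩
    · exact ⟨0, fun h => absurd h hε⟩
  choose pn hpn using hpn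
  -- the circuits of the approximants near the partners of `p`
  have hSk : ∀ ε : ℝ, ∃ S : Finset (EuclideanSpace ℝ (Fin 3)), 0 < ε → (↑S : Set (EuclideanSpace ℝ (Fin 3))) ⊆ Zs (k ε) ∧ (S.card : ℝ) ≤ M ∧
      (∀ y ∈ S, dist y (pn ε) ≤ L) ∧ (∀ s : ℝ, 0 < s → s < t → ∀ y ∈ S, CleanT a s (Zs (k ε)) y) ∧ ¬ Developable a S := by
    intro ε
    by_cases hε : 0 < ε
    · obtain ⟨S, h1, h2, h3, h4, h5⟩ := hBD (k ε) (pn ε) (hpn ε hε).1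
      exact ⟨S, fun _ => ⟨h1, h2, h3, h4, h5⟩⟩
    · exact ⟨∅, fun h => absurd h hε⟩
  choose Sk hSk using hSk
  have hSn : ∀ ε, 0 < ε → ε ≤ 1 → ∀ y ∈ Sk ε, ‖y‖ ≤ ‖p‖ + |L| + 1 := by
    intro ε hε hε1 y hy
    have h1 := norm_le_of_dist_le ((hSk ε hε).2.2.1 y hy)
    have h2 := norm_le_of_dist_le (hpn ε hε).2
    linarith [le_abs_self L]
  -- partner maps back into `Z`
  have hφ : ∀ ε : ℝ, ∃ φ : (EuclideanSpace ℝ (Fin 3)) → (EuclideanSpace ℝ (Fin 3)), 0 < ε →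
      ∀ y ∈ Zs (k ε), dist y 0 ≤ R₀ → φ y ∈ Z ∧ dist y (φ y) ≤ ε := by
    intro ε
    by_cases hε : 0 < ε
    · choose! φ h1 h2 using (hk ε hε).2
      exact ⟨φ, fun _ y hy hd => ⟨h1 y hy hd, h2 y hy hd⟩⟩
    · exact ⟨id, fun h => absurd h hε⟩
  choose φ hφ using hφ
  have hφS : ∀ ε, 0 < ε → ε ≤ 1 → ∀ y ∈ Sk ε, φ ε y ∈ Z ∧ dist y (φ ε y) ≤ ε := by
    intro ε hε hε1 y hy
    refine hφ ε hε y ((hSk ε hε).1 (Finset.mem_coe.2 hy)) ?_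
    rw [dist_zero_right]; linarith [hSn ε hε hε1 y hy, abs_nonneg L]
  -- the transported circuits live in a finite family of subsets of a ball of `Z`
  have hWfin : (Z ∩ closedBall p (|L| + 2)).Finite := UniformlyDiscrete.finite_inter_closedBall (X := Z) ⟨δ, hδ, hsep⟩ p (|L| + 2)
  set PP : Finset (Finset (EuclideanSpace ℝ (Fin 3))) := hWfin.toFinset.powerset with hPP
  have hTPP : ∀ ε, 0 < ε → ε ≤ 1 → (Sk ε).image (φ ε) ∈ PP := by
    intro ε hε hε1
    rw [Finset.mem_powerset]
    intro q hq
    rw [Set.Finite.mem_toFinset]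
    obtain ⟨y, hy, rfl⟩ := Finset.mem_image.1 hq
    refine ⟨(hφS ε hε hε1 y hy).1, mem_closedBall.2 ?_⟩
    have h1 := dist_triangle (φ ε y) y p
    have h2 := dist_triangle y (pn ε) p
    have h3 := dist_comm (φ ε y) y
    linarith [(hφS ε hε hε1 y hy).2, (hSk ε hε).2.2.1 y hy, (hpn ε hε).2, le_abs_self L]
  obtain ⟨S₀, hS₀, hfreq⟩ : ∃ S₀ ∈ PP, ∃ᶠ ε in 𝓝[>] (0 : ℝ), (Sk ε).image (φ ε) = S₀ := by
    by_contra hno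
    push Not at hno
    have h1 : ∀ᶠ ε in 𝓝[>] (0 : ℝ), ∀ S₀ ∈ PP, (Sk ε).image (φ ε) ≠ S₀ := PP.eventually_all.2 fun S₀ hS₀ => hno S₀ hS₀
    have h2 : ∀ᶠ ε in 𝓝[>] (0 : ℝ), ε < 1 := (eventually_lt_nhds one_pos).filter_mono nhdsWithin_le_nhds
    have h3 : ∀ᶠ ε in 𝓝[>] (0 : ℝ), 0 < ε := eventually_mem_nhdsWithin
    obtain ⟨ε, hε1, hε2, hε3⟩ := (h1.and (h2.and h3)).exists
    exact hε1 _ (hTPP ε hε3 hε2.le) rfl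
  have hsmall : ∀ ε₀ : ℝ, 0 < ε₀ → ∃ ε : ℝ, 0 < ε ∧ ε < ε₀ ∧ ε ≤ 1 ∧ (Sk ε).image (φ ε) = S₀ := by
    intro ε₀ hε₀
    have h2 : ∀ᶠ ε in 𝓝[>] (0 : ℝ), ε < ε₀ := (eventually_lt_nhds hε₀).filter_mono nhdsWithin_le_nhds
    have h2' : ∀ᶠ ε in 𝓝[>] (0 : ℝ), ε < 1 := (eventually_lt_nhds one_pos).filter_mono nhdsWithin_le_nhds
    have h3 : ∀ᶠ ε in 𝓝[>] (0 : ℝ), 0 < ε := eventually_mem_nhdsWithin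
    obtain ⟨ε, hz, hlt, hlt1, hpos⟩ := (hfreq.and_eventually (h2.and (h2'.and h3))).exists
    exact ⟨ε, hpos, hlt, hlt1.le, hz⟩
  have hS₀Z : (↑S₀ : Set (EuclideanSpace ℝ (Fin 3))) ⊆ Z := by
    intro q hq
    have := Finset.mem_powerset.1 hS₀ (Finset.mem_coe.1 hq)
    rw [Set.Finite.mem_toFinset] at this
    exact this.1
  refine ⟨S₀, hS₀Z, ?_, fun y' hy' => ?_, fun s hs hst y' hy' => ?_, fun hD => ?_⟩
  · -- cardinality
    obtain ⟨ε, hε, -, hε1, hT⟩ := hsmall 1 one_pos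
    rw [← hT]
    exact le_trans (by exact_mod_cast Finset.card_image_le) (hSk ε hε).2.1
  · -- distance to `p`
    refine le_of_forall_pos_lt_add fun τ hτ => ?_
    obtain ⟨ε, hε, hετ, hε1, hT⟩ := hsmall (τ / 3) (by linarith)
    rw [← hT] at hy'
    obtain ⟨y, hy, rfl⟩ := Finset.mem_image.1 hy'
    have h1 := dist_triangle (φ ε y) y p
    have h2 := dist_triangle y (pn ε) p
    have h3 := dist_comm (φ ε y) y
    linarith [(hφS ε hε hε1 y hy).2, (hSk ε hε).2.2.1 y hy, (hpn ε hε).2]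
  · -- cleanness at margin `s < t`, from margin `s + 3ε < t` in the approximant
    obtain ⟨ε, hε, hεs, hε1, hT⟩ := hsmall (min ((t - s) / 3) (min (δ / 4) (1 / 200))) (by positivity)
    have hε3 : 3 * ε < t - s := by
      have := min_le_left ((t - s) / 3) (min (δ / 4) (1 / 200)); linarith
    have hεδ : 2 * ε < δ := by
      have := (min_le_right ((t - s) / 3) (min (δ / 4) (1 / 200))).trans (min_le_left _ _); linarith
    have hεa : 100 * ε ≤ a := by
      have := (min_le_right ((t - s) / 3) (min (δ / 4) (1 / 200))).trans (min_le_right _ _); linarith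
    rw [← hT] at hy'
    obtain ⟨y, hy, rfl⟩ := Finset.mem_image.1 hy'
    have hc := (hSk ε hε).2.2.2.1 (s + 3 * ε) (by linarith) (by linarith) y hy
    have hta := margin_le_of_cleanT hc
    have hR1 : ‖y‖ + 2 * a ≤ R₀ := by linarith [hSn ε hε hε1 y hy, abs_nonneg L]
    exact cleanT_of_match' (hsepk _) hsep hε.le hεδ (hk ε hε) ha0 hεa (by linarith) hta (by linarith) (by nlinarith)
      ((hSk ε hε).1 (Finset.mem_coe.2 hy)) (hφS ε hε hε1 y hy).1 (hφS ε hε hε1 y hy).2 hR1 (Or.inl hs.le) hc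
  · -- undevelopability, pulled back along the partner map
    obtain ⟨ε, hε, hεs, hε1, hT⟩ := hsmall (min (t / 4) (min (δ / 4) (1 / 200))) (by positivity)
    have hε4 : 4 * ε < t := by
      have := min_le_left (t / 4) (min (δ / 4) (1 / 200)); linarith
    have hεδ : 2 * ε < δ := by
      have := (min_le_right (t / 4) (min (δ / 4) (1 / 200))).trans (min_le_left _ _); linarith
    have hε200 : ε ≤ 1 / 200 := by
      have := (min_le_right (t / 4) (min (δ / 4) (1 / 200))).trans (min_le_right _ _); linarith
    rw [← hT] at hD
    refine (hSk ε hε).2.2.2.2 (developable_of_contactEquiv (fun y hy y' hy' heq => ?_) (fun y hy y' hy' hne => ?_) hD)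
    · by_contra hne
      have h1 := hsepk _ y ((hSk ε hε).1 hy) y' ((hSk ε hε).1 hy') hne
      have h2 := dist_triangle y (φ ε y) y'
      have h3 : dist (φ ε y) y' ≤ ε := by rw [heq, dist_comm]; exact (hφS ε hε hε1 y' hy').2
      linarith [(hφS ε hε hε1 y hy).2]
    · have hc := (hSk ε hε).2.2.2.1 (2 * ε) (by linarith) (by linarith) y hy
      exact contact_iff_of_clean ha hε.le le_rfl ((hSk ε hε).1 (Finset.mem_coe.2 hy')) hne hc
        (hφS ε hε hε1 y hy).2 (hφS ε hε hε1 y' hy').2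

end Summit.AtomisticToContinuum.Crystallization.Theorems.OverbindingBudgetRecurrentDustClosureTwo

end
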